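import Mathlib.Algebra.MvPolynomial.CommRing
import Mathlib.Algebra.MvPolynomial.Monad
import Mathlib.Algebra.Polynomial.AlgebraMap
import Mathlib.Tactic.LinearCombination
import HarnessLib

/-!
# Killing the parameter: `T ↦ -X_z` in a one-parameter identity `g(X̃(T)) = g` (instrument for the `W(f)` toy model — NOT a resolution theorem)

Engine 1 of the RESOLUTION OBSERVATORY toy model `W(f)` (weighted-centre invariant in characteristic `p`) uses twice the
following move (gen 30 LEMMA ND0 "no pure translation", typed engine-specifically in `WeightedCentreNoPureTranslation`;
and again "one weight up" in the slope method, RE-DERIVATION-eng1-g42 §3.7 step (vii) / CARVER-NOTES-eng1-g42 §3 (vii),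
theorem T99a): from an identity

  `g(X̃(T) ε) = g(ε)` in `k[ε][T]`, where the substitution `X̃(T)` moves one slot by the parameter itself,
  `X̃(T)(ε_z) = ε_z + T`,

substitute `T := -ε_z` (a `k`-algebra map `k[ε][T] → k[ε]`): the composite substitution KILLS the slot `z`
(`ε_z ↦ 0`) and one reads off `g = Π″(G)` with `G := g|_{ε_z = 0}` free of `ε_z` and `Π″ : ε_i ↦ ε_i + N_i(-ε_z, ε)`
the specialised substitution on the other slots.  (When `Π″` is a graded unipotent automorphism — engine's situation,
cf. `triangularEquiv` in `WeightedCentreNoPureTranslation` — this says the slot `z` is not pinned in the coordinates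
`Π″⁻¹`, the contradiction the engine wants.)

This file types the generic algebra of that move (ours, bookkeeping), over any commutative ring:

* `eq_aeval_eval_of_map_eq_C` — if `φ g = C g` for a `k`-algebra map `φ : k[ε] → k[ε][T]`, then for every `Q ∈ k[ε]`,
  `g = g(ε_i ↦ (φ ε_i)(T := Q))`;
* `kill`, `aeval_kill_eq_of_forall_apply` / `notMem_vars_kill` — the substitution `ε_z ↦ 0` and that its output is `ε_z`-free;
* `aeval_update_comp_kill` — a substitution vanishing on `ε_z` factors through `kill z`;
* `exists_eq_aeval_of_map_eq_C` — the assembled statement: `φ (X z) = C (X z) + T` and `φ g = C g` give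
  `g = aeval Π″ G` with `z ∉ G.vars`, `G = kill z g`, `Π″ i = (φ (X i)).eval (-X z)` for `i ≠ z` and `Π″ z = X z`.

VALUE: bookkeeping for a toy model (Resolution Observatory cell `pub-rosobs`, carver lane gen 62; AI-written Lean; AI
review is weaker than expert review); NOT a statement about the invariant of [AbramovichTemkinWlodarczyk2024] and NOT
progress on the summit.  Reference frame for substitutions of polynomial rings: [Lang2002, Ch. IV §1]; the move itself
is the "translational" coordinate change of [Hauser2010, §D (p. 12)] read backwards.
-/

namespace Literature.AlgebraicGeometry.Resolution.WeightedBlowup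

namespace ParameterKill

open MvPolynomial

variable {k : Type*} [CommRing k] {ι : Type*}

/-- (ours, bookkeeping) **Specialising the parameter.** If a `k`-algebra map `φ : k[ε] → k[ε][T]` fixes `g` up to the
constant embedding (`φ g = C g`), then substituting any `Q ∈ k[ε]` for `T` exhibits `g` as the image of itself under the
specialised substitution `ε_i ↦ (φ ε_i)(T := Q)`. [cite: Lang2002, Ch. IV §1] -/
theorem eq_aeval_eval_of_map_eq_C (φ : MvPolynomial ι k →ₐ[k] Polynomial (MvPolynomial ι k)) (Q : MvPolynomial ι k)
    {g : MvPolynomial ι k} (hg : φ g = Polynomial.C g) :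
    g = aeval (fun i => (φ (X i)).eval Q) g := by
  have key : ((Polynomial.aeval Q).restrictScalars k).comp φ = aeval fun i => (φ (X i)).eval Q :=
    MvPolynomial.algHom_ext fun i => by
      rw [AlgHom.comp_apply, AlgHom.restrictScalars_apply, Polynomial.coe_aeval_eq_eval, aeval_X]
  have h := congrArg (fun ψ => ψ g) key
  simp only [AlgHom.comp_apply, AlgHom.restrictScalars_apply, Polynomial.coe_aeval_eq_eval, hg,
    Polynomial.eval_C] at h
  exact h

section Kill

variable [DecidableEq ι]

/-- (ours, bookkeeping) The substitution killing one slot: `ε_z ↦ 0`, the other variables fixed. [cite: Lang2002, Ch. IV §1] -/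
noncomputable def kill (z : ι) : MvPolynomial ι k →ₐ[k] MvPolynomial ι k :=
  aeval fun i => if i = z then 0 else X i

/-- (ours, bookkeeping) `kill z` sends `ε_z` to `0`. [cite: Lang2002, Ch. IV §1] -/
@[simp] theorem kill_X_self (z : ι) : kill (k := k) z (X z) = 0 := by
  simp [kill]

/-- (ours, bookkeeping) `kill z` fixes the other variables. [cite: Lang2002, Ch. IV §1] -/
@[simp] theorem kill_X_of_ne {z i : ι} (h : i ≠ z) : kill (k := k) z (X i) = X i := by
  simp [kill, h]

/-- (ours, bookkeeping) `kill z` fixes constants. [cite: Lang2002, Ch. IV §1] -/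
@[simp] theorem kill_C (z : ι) (a : k) : kill z (C a : MvPolynomial ι k) = C a := by
  simp [kill]

/-- (ours, bookkeeping) The output of `kill z` does not involve `ε_z`. [cite: Lang2002, Ch. IV §1] -/
theorem notMem_vars_kill (z : ι) (g : MvPolynomial ι k) : z ∉ (kill z g).vars := by
  intro hz
  rw [kill, aeval_eq_bind₁] at hz
  obtain ⟨i, -, hi⟩ := Finset.mem_biUnion.mp (vars_bind₁ _ g hz)
  by_cases hiz : i = z
  · simp [hiz] at hi
  · simp only [hiz, if_false] at hi
    rcases subsingleton_or_nontrivial k with hk | hk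
    · rw [Subsingleton.elim (X i : MvPolynomial ι k) 0, vars_0] at hi
      simp at hi
    · rw [vars_X, Finset.mem_singleton] at hi
      exact hiz hi.symm

/-- (ours, bookkeeping) A substitution that sends `ε_z` to `0` factors through `kill z`: replacing its value at `z` by
anything (here `X z`) and precomposing with `kill z` gives it back. [cite: Lang2002, Ch. IV §1] -/
theorem aeval_update_comp_kill (τ : ι → MvPolynomial ι k) {z : ι} (hz : τ z = 0) :
    (aeval (Function.update τ z (X z))).comp (kill (k := k) z) = aeval τ := by
  refine MvPolynomial.algHom_ext fun i => ?_
  by_cases hiz : i = z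
  · subst hiz
    rw [AlgHom.comp_apply, kill_X_self, map_zero, aeval_X, hz]
  · rw [AlgHom.comp_apply, kill_X_of_ne hiz, aeval_X, aeval_X, Function.update_of_ne hiz]

end Kill

/-- (ours, bookkeeping) **Killing the parameter (generic core of LEMMA ND0 / T99a (vii)).** Let `φ : k[ε] → k[ε][T]` be a
`k`-algebra map moving the slot `z` by the parameter, `φ ε_z = ε_z + T`, and let `φ g = C g` (the one-parameter family
fixes `g`).  Then `g = Π″(G)` where `G := kill z g` is free of `ε_z` and `Π″` substitutes `ε_i ↦ (φ ε_i)(T := -ε_z)` for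
`i ≠ z` (and fixes `ε_z`). [cite: Lang2002, Ch. IV §1] [cite: Hauser2010, §D (p. 12)] -/
theorem exists_eq_aeval_of_map_eq_C [DecidableEq ι] (φ : MvPolynomial ι k →ₐ[k] Polynomial (MvPolynomial ι k))
    {z : ι} (hz : φ (X z) = Polynomial.C (X z) + Polynomial.X) {g : MvPolynomial ι k} (hg : φ g = Polynomial.C g) :
    z ∉ (kill z g).vars ∧
      g = aeval (Function.update (fun i => (φ (X i)).eval (-X z)) z (X z)) (kill z g) := by
  refine ⟨notMem_vars_kill z g, ?_⟩
  have h0 : (fun i => (φ (X i)).eval (-X z)) z = 0 := by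
    simp only [hz, Polynomial.eval_add, Polynomial.eval_C, Polynomial.eval_X, add_neg_cancel]
  rw [← AlgHom.comp_apply, aeval_update_comp_kill _ h0]
  exact eq_aeval_eval_of_map_eq_C φ (-X z) hg

/-- (ours, bookkeeping) Variant with a unit slope: `φ ε_z = ε_z + c·T` with `c` a unit; substitute `T := -c⁻¹ ε_z`.
[cite: Lang2002, Ch. IV §1] -/
theorem exists_eq_aeval_of_map_eq_C_unit [DecidableEq ι] (φ : MvPolynomial ι k →ₐ[k] Polynomial (MvPolynomial ι k))
    {z : ι} {c : k} (hc : IsUnit c) (hz : φ (X z) = Polynomial.C (X z) + Polynomial.X * Polynomial.C (C c))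
    {g : MvPolynomial ι k} (hg : φ g = Polynomial.C g) :
    z ∉ (kill z g).vars ∧
      g = aeval (Function.update (fun i => (φ (X i)).eval (-(C ((hc.unit⁻¹ : kˣ) : k) * X z))) z (X z))
        (kill z g) := by
  refine ⟨notMem_vars_kill z g, ?_⟩
  have h0 : (fun i => (φ (X i)).eval (-(C ((hc.unit⁻¹ : kˣ) : k) * X z))) z = 0 := by
    have hu : C c * C ((hc.unit⁻¹ : kˣ) : k) = (1 : MvPolynomial ι k) := by
      rw [← C_mul, IsUnit.mul_val_inv, C_1]
    simp only [hz, Polynomial.eval_add, Polynomial.eval_C, Polynomial.eval_mul, Polynomial.eval_X]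
    linear_combination (-(X z : MvPolynomial ι k)) * hu
  rw [← AlgHom.comp_apply, aeval_update_comp_kill _ h0]
  exact eq_aeval_eval_of_map_eq_C φ _ hg

/-! ## Smoke test -/

section Smoke

/-- Smoke test (ours): two variables, `z = 0`; `φ` moves `ε_0 ↦ ε_0 + T` and fixes `ε_1`, so it fixes `g = ε_1`;
the conclusion reads `ε_1 = aeval Π″ (kill 0 ε_1)`. -/
example : (X 1 : MvPolynomial (Fin 2) ℤ) =
    aeval (Function.update (fun i => ((MvPolynomial.aeval (fun j : Fin 2 => if j = 0 then
      Polynomial.C (X 0) + Polynomial.X else Polynomial.C (X j)) :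
        MvPolynomial (Fin 2) ℤ →ₐ[ℤ] Polynomial (MvPolynomial (Fin 2) ℤ)) (X i)).eval (-X 0)) 0 (X 0))
      (kill 0 (X 1 : MvPolynomial (Fin 2) ℤ)) := by
  refine (exists_eq_aeval_of_map_eq_C _ (z := 0) ?_ ?_).2
  · rw [aeval_X]; simp
  · rw [aeval_X]; simp

end Smoke

end ParameterKill

end Literature.AlgebraicGeometry.Resolution.WeightedBlowup
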